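import Summits.ResolutionOfSingularities.ResolutionOfSingularities.Theorems.PurelyInseparableDim4HeightBudgetFalse
import Summits.ResolutionOfSingularities.ResolutionOfSingularities.Theorems.PurelyInseparableDim4HeightOneExactData
import Summits.ResolutionOfSingularities.ResolutionOfSingularities.Theorems.PurelyInseparableDim4WideRise
import Summits.ResolutionOfSingularities.ResolutionOfSingularities.Theorems.PurelyInseparableDim4WideNonTangent
import HarnessLib
import HarnessLib.Audit.Tags

/-!
# H1 EXACT ‖ K: `μ⁺ = 5, 5, 4, 3, 2, 1` and `ē = 2, 1` along crit-4's chain — the wide → narrow EQUAL edge is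
# NON-TANGENT, and (N1) is TIGHT (cell `res-dim4-pi`, seat p-7 g2; sequel of `…HeightBudgetFalse`)

[OURS · counted 0 · kernel-certified facts about ONE `𝔽₃` chain of this cell's census; nothing here is a
statement about resolution of singularities — resolution in dimension ≥ 4 / characteristic `p` is NOT proved.]

res-dim4-p-12 g2's `…HeightBudgetFalse` (p662571) certified crit-4's witness H1 (`¬ HeightBudget 3 3`):
`c₀ = uv² + u²v + 2x²uv + y⁵ + xyu³ + x²y²u` —x-chart origin→ `c₁` —y-chart origin→ `c₂ → c₃ → c₄ → c₅`
(`x, y, u, v = x₀, x₁, x₂, x₃`), six isolated `3`-fold states, `μ⁺(c₀) ≤ 5`.  With the colength LOWER bounds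
of `…ColengthLower` (p663793) this file completes the row:

* **`jetColength_c0 … jetColength_c5`** — `μ⁺ = 5, 5, 4, 3, 2, 1` EXACTLY, at the certificate levels
  `3, 5, 4, 3, 2, 1` (standard monomials of `c₁ … c₅`: `1, y, …, y^{μ⁺−1}` — curvilinear in `y`, L1's picture);
* **`ebar_c0 : ē(c₀) = 2`** (wide: `e_x, e_y ∈ A(uv² + u²v)`, clean ⇒ `≤ 2`) and **`ebar_c1 : ē(c₁) = 1`**
  (narrow): the first edge is a NON-TANGENT move of a wide state — `x² ∈ J₃⁺(c₀) + 𝔪₀³` and its quadratic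
  part does not vanish at the direction `e_x`, so res-dim4-p-3 g2's (NT)(i)
  `RidgeBudget.ebar_step_lt_of_eval_ne_zero` (p-5 g2's `WideSuccessorRidge`) drops `ē` — while
  **`μ⁺` stays `5 → 5`**: `exists_wide_to_narrow_edge_jetColength_eq` (a third wide non-drop specimen ‖ K,
  after `…WideNonDrop` `10 → 10` and `…WideRise` `6 → 7`);
* **`narrowDrop_tight`** — (N1) `RidgeBudget.narrowDrop` (p662631: `μ⁺(s⁺) ≤ μ⁺(s) − 1` on narrow isolated
  edges) is TIGHT: the narrow edge `c₁ → c₂` has `μ⁺ = 5 → 4` exactly (and the staircase continues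
  `4 → 3 → 2 → 1`).

Certificate data in `…HeightOneExactData`; states, edges and isolation from `…HeightBudgetFalse` (cited, not
restated).  bears_on: LADDER-RESOLUTION:D157-DOOR2 (res-dim4-pi · F4-I(3,3) · μ⁺ rows ‖ K · I-3-8/I-3-10).
Supports stmt-ResolutionOfSingularities-16155 (helper).
-/

set_option linter.dupNamespace false -- mandated namespace of this single-conjunct summit

noncomputable section

open MvPolynomial Finset

namespace Summit.ResolutionOfSingularities.ResolutionOfSingularities.Theorems.PIDim4

namespace HeightOneExact

open StepKit ScopeCover ColengthCert
open Literature.AlgebraicGeometry.Resolution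
open Literature.AlgebraicGeometry.Resolution.Hauser2010
open Literature.AlgebraicGeometry.Resolution.HauserPerlega2019
open Literature.Barriers.ResolutionOfSingularities
open PointBlowup (additiveSubspace gradSpan)
open HeightBudgetFalse (s0 s1 s2 s3 s4 s5 L0 L1)

/-! ## §1 Exact `μ⁺` along H1 -/

/-- **`μ⁺(c₀) = 5`** (upper bound: p-12 g2's `HeightBudgetFalse.jetColength0_le`; lower: dual rows `D0`).
[OURS · ‖ K] [folklore] -/
theorem jetColength_c0 : RidgeBudget.jetColength 3 3 s0.toState.F = 5 :=
  le_antisymm HeightBudgetFalse.jetColength0_le (length_le_jetColength_of_dualCertB (D := D0) (by decide +kernel))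

/-- **`μ⁺(c₁) = 5`** (level `5`). [OURS · ‖ K] [folklore] -/
theorem jetColength_c1 : RidgeBudget.jetColength 3 5 s1.toState.F = 5 :=
  le_antisymm (jetColength_le_of_colengthCertB (B := B1) (cert := S1) (by decide +kernel))
    (length_le_jetColength_of_dualCertB (D := D1) (by decide +kernel))

/-- **`μ⁺(c₂) = 4`** (level `4`). [OURS · ‖ K] [folklore] -/
theorem jetColength_c2 : RidgeBudget.jetColength 3 4 s2.toState.F = 4 :=
  le_antisymm (jetColength_le_of_colengthCertB (B := B2) (cert := S2) (by decide +kernel))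
    (length_le_jetColength_of_dualCertB (D := D2) (by decide +kernel))

/-- **`μ⁺(c₃) = 3`** (level `3`). [OURS · ‖ K] [folklore] -/
theorem jetColength_c3 : RidgeBudget.jetColength 3 3 s3.toState.F = 3 :=
  le_antisymm (jetColength_le_of_colengthCertB (B := B3) (cert := S3) (by decide +kernel))
    (length_le_jetColength_of_dualCertB (D := D3) (by decide +kernel))

/-- **`μ⁺(c₄) = 2`** (level `2`). [OURS · ‖ K] [folklore] -/
theorem jetColength_c4 : RidgeBudget.jetColength 3 2 s4.toState.F = 2 :=
  le_antisymm (jetColength_le_of_colengthCertB (B := B4) (cert := S4) (by decide +kernel))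
    (length_le_jetColength_of_dualCertB (D := D4) (by decide +kernel))

/-- **`μ⁺(c₅) = 1`** (level `1`). [OURS · ‖ K] [folklore] -/
theorem jetColength_c5 : RidgeBudget.jetColength 3 1 s5.toState.F = 1 :=
  le_antisymm (jetColength_le_of_colengthCertB (B := B5) (cert := S5) (by decide +kernel))
    (length_le_jetColength_of_dualCertB (D := D5) (by decide +kernel))

/-- Certificate levels are certificate levels (`IsCert`), so these ARE the stable colengths `μ⁺`
(`RidgeBudget.jetColength_eq_of_isCert`). [folklore] -/
theorem isCert_all :
    RidgeBudget.IsCert 3 3 s0.toState.F ∧ RidgeBudget.IsCert 3 5 s1.toState.F ∧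
      RidgeBudget.IsCert 3 4 s2.toState.F ∧ RidgeBudget.IsCert 3 3 s3.toState.F ∧
        RidgeBudget.IsCert 3 2 s4.toState.F ∧ RidgeBudget.IsCert 3 1 s5.toState.F :=
  ⟨HeightBudgetFalse.isCert0,
    isCert_of_isoCertB (cert := HeightBudgetFalse.R1) (by decide +kernel),
    isCert_of_isoCertB (cert := HeightBudgetFalse.R2) (by decide +kernel),
    isCert_of_isoCertB (cert := HeightBudgetFalse.R3) (by decide +kernel),
    isCert_of_isoCertB (cert := HeightBudgetFalse.R4) (by decide +kernel),
    isCert_of_isoCertB (cert := HeightBudgetFalse.R5) (by decide +kernel)⟩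

/-! ## §2 The directrix letters: `ē(c₀) = 2` (wide), `ē(c₁) = 1` (narrow); the first edge is NON-TANGENT -/

/-- `ord₀ c₀ = 3`. [folklore] -/
theorem ordZero_c0 : ordZero s0.toState.F = 3 := by
  rw [SData.toState_F, ordZero_evalT]; decide

/-- `ord₀ c₁ = 3`. [folklore] -/
theorem ordZero_c1 : ordZero s1.toState.F = 3 := by
  rw [SData.toState_F, ordZero_evalT]; decide

/-- `c₀` is clean. [folklore] -/
theorem isClean_c0 : HauserPerlega.IsClean 3 s0.toState.F := by
  rw [SData.toState_F]
  exact WideNonDrop.isClean_evalT_of_live (by decide)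

/-- The degree-`3` part of `c₀` is `uv² + u²v`: degree-`3` exponents involving `x` or `y` have coefficient `0`.
[folklore] -/
theorem coeff_c0_eq_zero {d : Fin 4 →₀ ℕ} (hd : d.degree = 3) (hxy : 0 < d 0 ∨ 0 < d 1) :
    coeff d s0.toState.F = 0 := by
  rw [SData.toState_F]
  refine WideRise.coeff_evalT_eq_zero_of_all (fun e => decide (∑ i, e i = 3 ∧ (0 < e 0 ∨ 0 < e 1)))
    (by decide) ?_
  rw [decide_eq_true_iff, ← ColengthCert.degree_eq_sum_coe]
  exact ⟨hd, hxy⟩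

/-- `e_x, e_y ∈ A(in c₀)`. [folklore] -/
theorem single_mem_additiveSubspace_c0 {k : Fin 4} (hk : k = 0 ∨ k = 1) :
    (Pi.single k 1 : Fin 4 → ZMod 3) ∈ additiveSubspace (initialForm s0.toState.F) := by
  rw [NarrowApolarity.mem_additiveSubspace_iff_forall (q := 3) ordZero_c0]
  intro β hβ
  refine Finset.sum_eq_zero fun i _ => ?_
  by_cases hik : i = k
  · subst hik
    rw [coeff_c0_eq_zero (by rw [NarrowApolarity.degree_add_single]; omega) ?_, zero_mul, mul_zero]
    rcases hk with rfl | rfl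
    · left; simp
    · right; simp
  · rw [Pi.single_eq_of_ne hik, zero_mul]

/-- **`ē(c₀) = 2`**: wide. [OURS · ‖ K] [folklore] -/
theorem ebar_c0 : RidgeBudget.ebar s0.toState.F = 2 := by
  refine le_antisymm (Directrix.finrank_additiveSubspace_initialForm_le_two 3 ordZero_c0 isClean_c0) ?_
  have hli : LinearIndependent (ZMod 3) ![(Pi.single 0 1 : Fin 4 → ZMod 3), Pi.single 1 1] := by
    rw [LinearIndependent.pair_iff]
    intro s t hst
    have h0 := congrFun hst 0
    have h1 := congrFun hst 1
    simp at h0 h1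
    exact ⟨h0, h1⟩
  have hle : Submodule.span (ZMod 3) (Set.range ![(Pi.single 0 1 : Fin 4 → ZMod 3), Pi.single 1 1]) ≤
      additiveSubspace (initialForm s0.toState.F) := by
    rw [Submodule.span_le]
    rintro _ ⟨i, rfl⟩
    fin_cases i
    · exact single_mem_additiveSubspace_c0 (Or.inl rfl)
    · exact single_mem_additiveSubspace_c0 (Or.inr rfl)
  have h := Submodule.finrank_mono hle
  rw [finrank_span_eq_card hli, Fintype.card_fin] at h
  exact h

/-- `x² ∈ J₃⁺(c₀) + 𝔪₀³` (membership row `rowXsq`). [folklore] -/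
theorem X_sq_mem_c0 : (X 0 : MvPolynomial (Fin 4) (ZMod 3)) ^ 2 ∈
    singLocusIdeal 3 s0.toState.F ⊔ originIdeal (ZMod 3) ^ 3 := by
  have h := monomial_mem_of_memRowB (q := 3) (M := 3) (L := L0) (γ := ![2, 0, 0, 0]) (row := rowXsq)
    (by decide +kernel)
  have hexp : expo ![2, 0, 0, 0] = Finsupp.single (0 : Fin 4) 2 := by
    ext i
    fin_cases i <;> simp [expo_apply]
  have he : monomial (expo ![2, 0, 0, 0]) (1 : ZMod 3) = X 0 ^ 2 := by
    rw [hexp, X_pow_eq_monomial]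
  rw [SData.toState_F]
  rwa [he] at h

/-- **`ē(c₁) = 1`**: the edge `c₀ → c₁` (x-chart, origin) is a NON-TANGENT move of the wide state `c₀`
(`x²`'s quadratic part is `1 ≠ 0` at the direction `e_x`), so `ē` drops by (NT)(i)
(`RidgeBudget.ebar_step_lt_of_eval_ne_zero`, res-dim4-p-3 g2 / p-5 g2); and `ē(c₁) ≥ 1` since `c₁` has a
`Step0` successor. [OURS · ‖ K] [cite: CossartJannsenSaito2020, Thm. 3.10 (4) and Thm. 3.14] -/
theorem ebar_c1 : RidgeBudget.ebar s1.toState.F = 1 := by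
  have hstep : CentreBlowup.step 3 Finset.univ 0 0 s0.toState = s1.toState :=
    (StepKit.step_eq_iff 3 Finset.univ 0 0 s0 s1).mpr (by decide)
  have heq : CentreBlowup.IsEquimultiplePoint 3 Finset.univ 0 0 s0.toState :=
    (StepKit.isEquimultiplePoint_iff 3 Finset.univ 0 0 s0).mpr (by decide)
  have hgrad : gradSpan (initialForm s0.toState.F) ≠ ⊥ :=
    (Directrix.gradSpan_ne_bot_iff_finrank_additiveSubspace_le _).mpr (by
      have h := ebar_c0; rw [RidgeBudget.ebar] at h; omega)
  have hg2 : ∀ A ∈ ((X 0 : MvPolynomial (Fin 4) (ZMod 3)) ^ 2).support, 2 ≤ A.degree := by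
    intro A hA
    rw [X_pow_eq_monomial, support_monomial, if_neg one_ne_zero, Finset.mem_singleton] at hA
    rw [hA, Finsupp.degree_single]
  have hw : eval (Function.update (0 : Fin 4 → ZMod 3) 0 1)
      (homogeneousComponent 2 ((X 0 : MvPolynomial (Fin 4) (ZMod 3)) ^ 2)) ≠ 0 := by
    rw [homogeneousComponent_of_mem (isHomogeneous_X_pow (0 : Fin 4) 2), if_pos rfl, map_pow, eval_X,
      Function.update_self, one_pow]
    exact one_ne_zero
  have hlt := RidgeBudget.ebar_step_lt_of_eval_ne_zero 3 ordZero_c0 hgrad (by rfl) heq (le_refl 3)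
    X_sq_mem_c0 hg2 hw
  rw [hstep, ebar_c0] at hlt
  have hge : 1 ≤ RidgeBudget.ebar s1.toState.F :=
    Directrix.one_le_finrank_additiveSubspace_of_step0 3 ordZero_c1 HeightBudgetFalse.step12
  omega

/-! ## §3 The two readings -/

/-- **A WIDE → NARROW isolated edge with `μ⁺` EQUAL (`5 → 5`)** — third non-drop specimen ‖ K, and the only
kind not covered by `…WideNonDrop` (wide → wide): H1's first edge. [OURS · ‖ K] [folklore] -/
theorem exists_wide_to_narrow_edge_jetColength_eq :
    ∃ (s s' : State (ZMod 3)), IsIsolated 3 s.F ∧ IsIsolated 3 s'.F ∧ Step0 3 s s' ∧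
      ordZero s.F = 3 ∧ RidgeBudget.ebar s.F = 2 ∧ RidgeBudget.ebar s'.F = 1 ∧
        RidgeBudget.IsCert 3 3 s.F ∧ RidgeBudget.IsCert 3 5 s'.F ∧
          RidgeBudget.jetColength 3 3 s.F = 5 ∧ RidgeBudget.jetColength 3 5 s'.F = 5 :=
  ⟨s0.toState, s1.toState, HeightBudgetFalse.iso0, HeightBudgetFalse.iso1, HeightBudgetFalse.step01,
    ordZero_c0, ebar_c0, ebar_c1, isCert_all.1, isCert_all.2.1, jetColength_c0, jetColength_c1⟩

/-- **(N1) IS TIGHT**: on the narrow isolated edge `c₁ → c₂` the colength drops by EXACTLY one (`5 → 4`),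
so `RidgeBudget.narrowDrop`'s `μ⁺(s⁺) ≤ μ⁺(s) − 1` cannot be improved. [OURS · ‖ K] [folklore] -/
theorem narrowDrop_tight :
    ∃ (s s' : State (ZMod 3)), IsIsolated 3 s.F ∧ IsIsolated 3 s'.F ∧ Step0 3 s s' ∧
      ordZero s.F = 3 ∧ RidgeBudget.ebar s.F = 1 ∧ RidgeBudget.IsCert 3 5 s.F ∧ RidgeBudget.IsCert 3 4 s'.F ∧
        RidgeBudget.jetColength 3 4 s'.F + 1 = RidgeBudget.jetColength 3 5 s.F :=
  ⟨s1.toState, s2.toState, HeightBudgetFalse.iso1, HeightBudgetFalse.iso2, HeightBudgetFalse.step12,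
    ordZero_c1, ebar_c1, isCert_all.2.1, isCert_all.2.2.1, by rw [jetColength_c1, jetColength_c2]⟩

/-- The full staircase `μ⁺ = 5, 5, 4, 3, 2, 1` along H1, as one conjunction. [OURS · ‖ K] [folklore] -/
theorem staircase :
    RidgeBudget.jetColength 3 3 s0.toState.F = 5 ∧ RidgeBudget.jetColength 3 5 s1.toState.F = 5 ∧
      RidgeBudget.jetColength 3 4 s2.toState.F = 4 ∧ RidgeBudget.jetColength 3 3 s3.toState.F = 3 ∧
        RidgeBudget.jetColength 3 2 s4.toState.F = 2 ∧ RidgeBudget.jetColength 3 1 s5.toState.F = 1 :=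
  ⟨jetColength_c0, jetColength_c1, jetColength_c2, jetColength_c3, jetColength_c4, jetColength_c5⟩

end HeightOneExact

end Summit.ResolutionOfSingularities.ResolutionOfSingularities.Theorems.PIDim4

end
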